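import Summits.QuantumFields.YangMills.Theorems.BalabanUVNodesN15CurvedGluingCubeDressedGeneralRows
import HarnessLib

/-!
# Route «BalabanUVNodes» (cluster K4 «SpineRates»), Track-A DAG node N15 = NE2, BACKGROUND LAYER — THE RIGHT ENTRIES OF THE GENERAL DRESSED CUBE, TWO-SIDED LOCALIZED, AND THEIR
# η-DEFECTS: `(pr_jX̂)∘Q ≤ 1_S(y)1_S(y′)·β₂(1 − βRc_r²)⁻¹e^{−ρ₂d}` (FILE 55's `hGE`∕`hIGE` proper; FILE 49 ∕ FILE 53 ∕ file 14 ∕ file 15's `hD`∕`hDb`∕`hDD`∕`hDDb` at `G := pr₀X̂` — the inputs of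
# every ADJOINT-arrangement commutator row `X∘[Δ_a, M_h]`)

Cell `pub-ymgap`, seat `pub-ymgap-dag-n15-w3` (WIDTH SEAT 3∕3 on node N15, director-ym №197 ∕ HUMAN RULING D-0149; plan `W-SEAT-START-LIST.md` §n15 item 3 «LG-vector + background layers at
GENERAL small-field U» — twenty-ninth piece).  `bears_on: R4∕N15 · K3⁷ SpineGivenEndpointR13SepCoPH (stmt-QuantumFields-20544)`.  Filed `--kind proof --supports stmt-QuantumFields-20544 --as
helper` — COUNT-NEUTRAL.  Theorems only; 0 `sorry`.  Imports BY NAME file 25 `…N15CurvedGluingCubeDressedGeneralRows` (`projO_dressedV_cutoffs`, `hasMaj_idef_dressedV_comp`; through it file 23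
`hasMaj_dressedV_comp`, `hasMaj_dressedV_pair`, `dressedV_comp_eq_self`, file 24 `idef_out_in`, file 21 `mulOp_eq_zero_of_vanish`; dag-n15-c B2 `stack`∕`projO`∕`hasMaj_projO_comp`, B1a `bgPropV`,
FILE 47 `hasMaj_localize`; n15-b `fgrad`∕`bgrad`∕`liftEquiv`); nothing in the tree is modified.

WHY.  The per-cube ADJOINT rows of dag-n15-c's gluing (FILE 49 `hasMaj_comp_commOp_lapOp`, FILE 53 `hasMaj_comp_commOp_covLapM`, this seat's file 14 `hasMaj_comp_commOp_speciesOpM`, and their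
η-defect twins FILE 53 `hasMaj_idef_comp_commOp_covLapM` ∕ file 15) read the cube through its RIGHT entries `G∘∇^±_μ`, TWO-SIDED localized `1_S(y)1_S(y′)·β₁e^{−δd}`, and FILE 55's `hGE`∕`hIGE`
rows want `G_□∘E` in the same two-sided currency.  For the GENERAL dressed cube `X̂ = (1 − ŜV̂)⁻¹Ŝ` of file 23 (arbitrary decaying perturbation `V̂` of the jet — species (3.52), words (3.60),
the nonlocal `P₁(A)` (3.76)) files 23∕25 give the right entries `X̂∘Q` and their defects UNlocalized only.  THIS FILE localizes them on both sides.  Output: the flat component's cut-off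
`M_χ∘pr_jŜ = pr_jŜ` passes to `pr_jX̂ = pr_jŜ∘(1 + V̂X̂)` (file 25 `projO_dressedV_cutoffs`).  Input: a first-order `Q` reads one lattice step beyond the flat piece's input cut-off `ψ`, so
the honest hypothesis is the print's NESTED pair of cut-offs `□ ⊂ □̃` ([B6] (2.133) p.247 «y′ ∈ 𝔅 ∩ T_□»): `M_ψ∘Q∘M_{ψ₂} = M_ψ∘Q` (`ψ₂ ≡ 1` on `supp ψ` and its one-step translates — §1 for
`Q = ∇^±_μ`), `supp ψ₂` over `S`; then `X̂∘Q = X̂∘M_ψ∘Q = X̂∘Q∘M_{ψ₂}` reads inputs over `S` only.  The two-grid defects follow by file 24 `idef_out_in` at both grids.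

* §1 `mulOp_comp_fgrad_comp_mulOp_of_margin` ∕ `mulOp_comp_bgrad_comp_mulOp_of_margin` (the nested cut-off identity for `∇^±_μ` from the one-step margin), `dressedV_comp_comp_mulOp`
  (`X̂∘Q∘M_{ψ₂} = X̂∘Q`), `projO_dressedV_comp_cutoffs` (both cut-offs of `(pr_jX̂)∘Q`);
* §2 ★★ `hasMaj_projO_dressedV_comp_loc₂` (every component: `(pr_jX̂)∘Q ≤ 1_S(y)1_S(y′)·β₂(1 − βRc_r²)⁻¹e^{−ρ₂d}`), ★★ `hasMaj_dressedV_comp_fgrad_loc₂` ∕ `hasMaj_dressedV_comp_bgrad_loc₂` (`j = none`,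
  `Q = ∇^±_μ`: FILE 49 ∕ file 14's `hD`∕`hDb` at `G := pr₀X̂` BY SHAPE);
* §3 ★★ `hasMaj_idef_projO_dressedV_comp_loc₂_of` (two-sided localization of ANY defect letter of the right entries), ★★ `hasMaj_idef_projO_dressedV_comp_loc₂` (BY NAME on file 25's letter = FILE
  55 `hIGE` proper), `hasMaj_idef_dressedV_comp_fgrad_loc₂` ∕ `hasMaj_idef_dressedV_comp_bgrad_loc₂` (file 15 ∕ FILE 53-type `hDD`∕`hDDb` inputs at `G := pr₀X̂`).

HONEST FRAMING ∕ LIMITS.  Finite-dimensional support bookkeeping + file 23's Neumann letters over DISPLAYED flat-cube data (`G₀, D_j, G₀Q, D_jQ` letters and defects, cut-offs `χ, ψ, ψ₂`, the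
perturbation's decay letter `R, δ_V` and fit `o`); nothing of [B6]∕[B9] asserted ((2.133) p. 247, (3.42) p. 397, (3.63)–(3.65) pp. 402–403, Thm 3.14 = SHAPES ∕ MECHANISM ∕ TEMPLATE).  NE2⁺ NOT
PRINTED, NOT proved; N15 NOT discharged; counts of record UNMOVED (typed 28∕28 · discharged 5∕27); one finite 𝕋⁴ at fixed ε — NOT infinite volume, NOT OS on ℝ⁴, NOT a mass gap, NOT Clay; R4
closes the conditional finite-𝕋⁴ rung `BalabanLadder.UV` only.  Restate-immune (no Theses import).
-/

set_option autoImplicit false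

noncomputable section
open scoped BigOperators
open Finset

namespace Summit.QuantumFields.YangMills.BalabanUVNodes.N15.CurvedSpecies

open Literature.MathematicalPhysics.QuantumFieldTheory.Balaban1983to89
open Literature.MathematicalPhysics.QuantumFieldTheory.Balaban1983to89.B11SectG (BlockNorm HasMaj RowSum)
open Literature.MathematicalPhysics.QuantumFieldTheory.Balaban1983to89.B6RandomWalk (Triangle254)
open Literature.MathematicalPhysics.QuantumFieldTheory.Balaban1983to89.T4EtaRateDefect (idef idef_apply)
open Literature.MathematicalPhysics.QuantumFieldTheory.Balaban1983to89.T4EtaRateCoeffDefect (pull pull_apply)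
open Literature.MathematicalPhysics.QuantumFieldTheory.Balaban1983to89.B6Prop26Gluing (mulOp mulOp_apply ind ind_nonneg)
open Summit.QuantumFields.YangMills.BalabanUVNodes.N15.MatrixSpecies (liftBlk liftMap liftEquiv liftEquiv_apply liftEquiv_symm_apply)
open Summit.QuantumFields.YangMills.BalabanUVNodes.N15.BackgroundLayer (fgrad bgrad fgrad_apply bgrad_apply stack projO blkPair liftPair hasMaj_projO_comp bgPropV bgPropV_fix projO_none_comp_stack)
open Summit.QuantumFields.YangMills.BalabanUVNodes.N15.Gluing (hasMaj_localize)

/-! ## §1 Nested cut-offs: the one-step margin, and the cut-offs of a right entry of the dressed cube -/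

section Margin

variable {X ι : Type}

/-- THE NESTED CUT-OFF IDENTITY FOR `∇⁺_τ`: if `ψ₂ = 1` on `supp ψ` and on `τ(supp ψ)` then `M_ψ∘∇⁺_τ∘M_{ψ₂} = M_ψ∘∇⁺_τ` (the forward quotient at `x` reads `x` and `τx` only).
[cite: Balaban1984PropagatorsII, (2.133) p.247 («y′ ∈ 𝔅 ∩ T_□»: the enlarged cube; shape)] -/
theorem mulOp_comp_fgrad_comp_mulOp_of_margin (n : ℝ) (τ : X ≃ X) {ψX ψ₂X : X → ℝ} (hm : ∀ x, ψX x ≠ 0 → ψ₂X x = 1 ∧ ψ₂X (τ x) = 1) :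
    mulOp (fun p : X × ι => ψX p.1) ∘ₗ fgrad n (liftEquiv τ ι) ∘ₗ mulOp (fun p : X × ι => ψ₂X p.1) = mulOp (fun p : X × ι => ψX p.1) ∘ₗ fgrad n (liftEquiv τ ι) := by
  refine LinearMap.ext fun f => funext fun p => ?_
  by_cases h : ψX p.1 = 0
  · simp only [LinearMap.comp_apply, mulOp_apply, h, zero_mul]
  · obtain ⟨h1, h2⟩ := hm p.1 h
    simp only [LinearMap.comp_apply, mulOp_apply, fgrad_apply, liftEquiv_apply, h1, h2, one_mul]

/-- THE NESTED CUT-OFF IDENTITY FOR `∇⁻_τ`: if `ψ₂ = 1` on `supp ψ` and on `τ⁻¹(supp ψ)` then `M_ψ∘∇⁻_τ∘M_{ψ₂} = M_ψ∘∇⁻_τ`. [cite: Balaban1984PropagatorsII, (2.133) p.247 (shape)] -/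
theorem mulOp_comp_bgrad_comp_mulOp_of_margin (n : ℝ) (τ : X ≃ X) {ψX ψ₂X : X → ℝ} (hm : ∀ x, ψX x ≠ 0 → ψ₂X x = 1 ∧ ψ₂X (τ.symm x) = 1) :
    mulOp (fun p : X × ι => ψX p.1) ∘ₗ bgrad n (liftEquiv τ ι) ∘ₗ mulOp (fun p : X × ι => ψ₂X p.1) = mulOp (fun p : X × ι => ψX p.1) ∘ₗ bgrad n (liftEquiv τ ι) := by
  refine LinearMap.ext fun f => funext fun p => ?_
  by_cases h : ψX p.1 = 0
  · simp only [LinearMap.comp_apply, mulOp_apply, h, zero_mul]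
  · obtain ⟨h1, h2⟩ := hm p.1 h
    simp only [LinearMap.comp_apply, mulOp_apply, bgrad_apply, liftEquiv_symm_apply, h1, h2, one_mul]

end Margin

section Algebra

variable {Y K : Type} [Fintype Y] [Fintype K] [DecidableEq Y] [DecidableEq K] {G₀ : (Y → ℝ) →ₗ[ℝ] (Y → ℝ)} {D Dq : K → (Y → ℝ) →ₗ[ℝ] (Y → ℝ)}
  {V : (Y × Option K → ℝ) →ₗ[ℝ] (Y → ℝ)}

/-- `X̂∘Q∘M_{ψ₂} = X̂∘Q` from the flat piece's input cut-off `G₀ = G₀M_ψ` (`D_j = Dq_j∘G₀`, so `X̂ = X̂M_ψ`: file 23 `dressedV_comp_eq_self`) and the nested cut-off `M_ψ∘Q∘M_{ψ₂} = M_ψ∘Q`.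
[cite: Balaban1984PropagatorsII, (2.133) p.247 (shape)] -/
theorem dressedV_comp_comp_mulOp (hDq : ∀ j, D j = Dq j ∘ₗ G₀) {Q : (Y → ℝ) →ₗ[ℝ] (Y → ℝ)} {ψ ψ₂ : Y → ℝ} (hGψ : G₀ ∘ₗ mulOp ψ = G₀) (hQ : mulOp ψ ∘ₗ Q ∘ₗ mulOp ψ₂ = mulOp ψ ∘ₗ Q) :
    (bgPropV (stack G₀ D) V ∘ₗ Q) ∘ₗ mulOp ψ₂ = bgPropV (stack G₀ D) V ∘ₗ Q := by
  have hX := dressedV_comp_eq_self (V := V) hDq hGψ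
  calc (bgPropV (stack G₀ D) V ∘ₗ Q) ∘ₗ mulOp ψ₂ = ((bgPropV (stack G₀ D) V ∘ₗ mulOp ψ) ∘ₗ Q) ∘ₗ mulOp ψ₂ := by rw [hX]
    _ = bgPropV (stack G₀ D) V ∘ₗ (mulOp ψ ∘ₗ Q ∘ₗ mulOp ψ₂) := by simp only [LinearMap.comp_assoc]
    _ = (bgPropV (stack G₀ D) V ∘ₗ mulOp ψ) ∘ₗ Q := by rw [hQ, LinearMap.comp_assoc]
    _ = bgPropV (stack G₀ D) V ∘ₗ Q := by rw [hX]

/-- BOTH CUT-OFFS OF A RIGHT ENTRY `(pr_jX̂)∘Q`: output from the flat component's `M_χ∘pr_jŜ = pr_jŜ`, input from the nested pair `ψ ⊂ ψ₂`. [cite: Balaban1984PropagatorsII, (2.133) p.247 (shape)] -/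
theorem projO_dressedV_comp_cutoffs (hDq : ∀ j, D j = Dq j ∘ₗ G₀) (hunit : IsUnit (1 - LinearMap.toMatrix' (stack G₀ D ∘ₗ V))) (j : Option K) {Q : (Y → ℝ) →ₗ[ℝ] (Y → ℝ)} {χ ψ ψ₂ : Y → ℝ}
    (hχ : mulOp χ ∘ₗ (projO j ∘ₗ stack G₀ D) = projO j ∘ₗ stack G₀ D) (hGψ : G₀ ∘ₗ mulOp ψ = G₀) (hQ : mulOp ψ ∘ₗ Q ∘ₗ mulOp ψ₂ = mulOp ψ ∘ₗ Q) :
    mulOp χ ∘ₗ ((projO j ∘ₗ bgPropV (stack G₀ D) V) ∘ₗ Q) = (projO j ∘ₗ bgPropV (stack G₀ D) V) ∘ₗ Q ∧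
      ((projO j ∘ₗ bgPropV (stack G₀ D) V) ∘ₗ Q) ∘ₗ mulOp ψ₂ = (projO j ∘ₗ bgPropV (stack G₀ D) V) ∘ₗ Q := by
  have hfix := bgPropV_fix hunit
  have hfac : projO j ∘ₗ bgPropV (stack G₀ D) V = (projO j ∘ₗ stack G₀ D) ∘ₗ (LinearMap.id + V ∘ₗ bgPropV (stack G₀ D) V) := by
    conv_lhs => rw [hfix]
    rw [LinearMap.comp_add, LinearMap.comp_add, LinearMap.comp_id, LinearMap.comp_assoc, LinearMap.comp_assoc]
  have hout : mulOp χ ∘ₗ (projO j ∘ₗ bgPropV (stack G₀ D) V) = projO j ∘ₗ bgPropV (stack G₀ D) V := by rw [hfac, ← LinearMap.comp_assoc, hχ]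
  refine ⟨?_, ?_⟩
  · rw [← LinearMap.comp_assoc, hout]
  · calc ((projO j ∘ₗ bgPropV (stack G₀ D) V) ∘ₗ Q) ∘ₗ mulOp ψ₂ = projO j ∘ₗ ((bgPropV (stack G₀ D) V ∘ₗ Q) ∘ₗ mulOp ψ₂) := by simp only [LinearMap.comp_assoc]
      _ = projO j ∘ₗ (bgPropV (stack G₀ D) V ∘ₗ Q) := by rw [dressedV_comp_comp_mulOp (V := V) hDq hGψ hQ]
      _ = (projO j ∘ₗ bgPropV (stack G₀ D) V) ∘ₗ Q := by rw [LinearMap.comp_assoc]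

end Algebra

/-! ## §2 The right entries, two-sided localized -/

section Rows

variable {X ι J : Type} [Fintype X] [DecidableEq X] [Fintype ι] [DecidableEq ι] [Fintype J] [DecidableEq J] {g : B6.Geometry} (blk : X → g.Site) {σ cr : ℝ}
  {G₀ : (X × ι → ℝ) →ₗ[ℝ] (X × ι → ℝ)} {D Dq : J ⊕ J → (X × ι → ℝ) →ₗ[ℝ] (X × ι → ℝ)} {V : ((X × ι) × Option (J ⊕ J) → ℝ) →ₗ[ℝ] (X × ι → ℝ)}

/-- ★★ **A RIGHT ENTRY OF THE GENERAL DRESSED CUBE, EVERY COMPONENT, TWO-SIDED LOCALIZED** (FILE 55's `hGE` currency): the flat right entries `G₀∘Q, D_j∘Q ≤ β₂e^{−δd}`, the pair data of file 23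
(`G₀, D_j ≤ βe^{−δd}`, `V̂ ≤ Re^{−δ_Vd}`, `βRc_r² < 1`), the flat component's output cut-off `M_χ∘pr_jŜ = pr_jŜ` (`supp χ` over `S`), the flat piece's input cut-off `G₀ = G₀M_ψ` (`D_j = Dq_j∘G₀`)
and the nested cut-off `M_ψ∘Q∘M_{ψ₂} = M_ψ∘Q` (`supp ψ₂` over `S`) ⟹ `(pr_jX̂)∘Q ≤ 1_S(y)1_S(y′)·β₂(1 − βRc_r²)⁻¹e^{−ρ₂d}`.
[cite: Balaban1984PropagatorsII, (2.133) p.247 (shape); Balaban1985BackgroundPropagators, (3.42) p.397 (entry 2), (3.63)–(3.65) pp.402–403 (mechanism)] -/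
theorem hasMaj_projO_dressedV_comp_loc₂ (htri : Triangle254 g) (hd : ∀ a b : g.Site, 0 ≤ g.dist a b) (hrow : RowSum g σ cr) (hσ : 0 ≤ σ) {ρ₁ ρ₂ δ δV β β₂ R : ℝ} (hβ : 0 ≤ β)
    (hβ₂ : 0 ≤ β₂) (hR : 0 ≤ R) (hcr : 0 ≤ cr) (hσρ : σ ≤ ρ₁) (hρ₁V : ρ₁ ≤ δV) (hρ₁G : ρ₁ + σ ≤ δ) (hρ₂ : 0 ≤ ρ₂) (hρ₂₁ : ρ₂ + σ ≤ ρ₁) (hDq : ∀ j, D j = Dq j ∘ₗ G₀)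
    (j : Option (J ⊕ J)) (Q : (X × ι → ℝ) →ₗ[ℝ] (X × ι → ℝ)) {S : Set g.Site} {χX ψX ψ₂X : X → ℝ} (hSχ : ∀ x, χX x ≠ 0 → blk x ∈ S) (hSψ₂ : ∀ x, ψ₂X x ≠ 0 → blk x ∈ S)
    (hχ : mulOp (fun p : X × ι => χX p.1) ∘ₗ (projO j ∘ₗ stack G₀ D) = projO j ∘ₗ stack G₀ D) (hGψ : G₀ ∘ₗ mulOp (fun p : X × ι => ψX p.1) = G₀)
    (hQ : mulOp (fun p : X × ι => ψX p.1) ∘ₗ Q ∘ₗ mulOp (fun p : X × ι => ψ₂X p.1) = mulOp (fun p : X × ι => ψX p.1) ∘ₗ Q)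
    (hG : HasMaj (BlockNorm.ofBlocks g (liftBlk blk ι)) (BlockNorm.ofBlocks g (liftBlk blk ι)) G₀ (fun y y' => β * Real.exp (-(δ * g.dist y y'))))
    (hD : ∀ j, HasMaj (BlockNorm.ofBlocks g (liftBlk blk ι)) (BlockNorm.ofBlocks g (liftBlk blk ι)) (D j) (fun y y' => β * Real.exp (-(δ * g.dist y y'))))
    (hGQ : HasMaj (BlockNorm.ofBlocks g (liftBlk blk ι)) (BlockNorm.ofBlocks g (liftBlk blk ι)) (G₀ ∘ₗ Q) (fun y y' => β₂ * Real.exp (-(δ * g.dist y y'))))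
    (hDQ : ∀ j, HasMaj (BlockNorm.ofBlocks g (liftBlk blk ι)) (BlockNorm.ofBlocks g (liftBlk blk ι)) (D j ∘ₗ Q) (fun y y' => β₂ * Real.exp (-(δ * g.dist y y'))))
    (hV : HasMaj (BlockNorm.ofBlocks g (blkPair (liftBlk blk ι))) (BlockNorm.ofBlocks g (liftBlk blk ι)) V (fun y y' => R * Real.exp (-(δV * g.dist y y'))))
    (hq : β * (R * cr) * cr < 1) :
    HasMaj (BlockNorm.ofBlocks g (liftBlk blk ι)) (BlockNorm.ofBlocks g (liftBlk blk ι)) ((projO j ∘ₗ bgPropV (stack G₀ D) V) ∘ₗ Q)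
      (fun y y' => ind S y * ind S y' * (β₂ * (1 - β * (R * cr) * cr)⁻¹ * Real.exp (-(ρ₂ * g.dist y y')))) := by
  obtain ⟨hunit, -⟩ := hasMaj_dressedV_pair blk htri hd hrow hσ hβ hR hcr hσρ hρ₁V hρ₁G hρ₂ hρ₂₁ hG hD hV hq
  have hXQ := hasMaj_dressedV_comp blk htri hd hrow hσ hβ hβ₂ hR hcr hσρ hρ₁V hρ₁G hρ₂ hρ₂₁ Q hG hD hGQ hDQ hV hq
  have key : HasMaj (BlockNorm.ofBlocks g (liftBlk blk ι)) (BlockNorm.ofBlocks g (liftBlk blk ι)) ((projO j ∘ₗ bgPropV (stack G₀ D) V) ∘ₗ Q)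
      (fun y y' => β₂ * (1 - β * (R * cr) * cr)⁻¹ * Real.exp (-(ρ₂ * g.dist y y'))) := by
    rw [LinearMap.comp_assoc]
    exact hasMaj_projO_comp (liftBlk blk ι) hXQ j
  have hβX : 0 ≤ β₂ * (1 - β * (R * cr) * cr)⁻¹ := mul_nonneg hβ₂ (inv_nonneg.2 (by linarith))
  obtain ⟨hout, hin⟩ := projO_dressedV_comp_cutoffs (V := V) hDq hunit j hχ hGψ hQ
  refine hasMaj_localize (liftBlk blk ι) (liftBlk blk ι) (fun a b => mul_nonneg hβX (Real.exp_nonneg _)) (fun μ p hp => ?_) (fun μ hμ => ?_) key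
  · have hχ0 : χX p.1 = 0 := by by_contra h; exact hp (hSχ p.1 h)
    rw [← hout]
    simp only [LinearMap.comp_apply, mulOp_apply, hχ0, zero_mul]
  · rw [← hin, LinearMap.comp_apply, mulOp_eq_zero_of_vanish blk hSψ₂ μ hμ, map_zero]

variable (τ : J → X ≃ X) (n : ℝ)

/-- ★★ **`X∘∇⁺_μ`, TWO-SIDED** — FILE 49 `hasMaj_comp_commOp_lapOp`'s ∕ file 14 `hasMaj_comp_commOp_speciesOpM`'s `hD` at `G := pr₀X̂`: the flat right entries `G₀∘∇⁺_μ, D_j∘∇⁺_μ ≤ β₂e^{−δd}`, the flat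
piece's cut-offs `G₀ = M_χG₀ = G₀M_ψ`, and the ONE-STEP MARGIN `ψ₂ = 1` on `supp ψ ∪ τ_μ(supp ψ)` (`supp ψ₂` over `S`) ⟹ `X∘∇⁺_μ ≤ 1_S(y)1_S(y′)·β₂(1 − βRc_r²)⁻¹e^{−ρ₂d}`.
[cite: Balaban1984PropagatorsII, (2.133)–(2.134) p.247 (shapes); Balaban1985BackgroundPropagators, (3.42) p.397, (3.65) p.403] -/
theorem hasMaj_dressedV_comp_fgrad_loc₂ (htri : Triangle254 g) (hd : ∀ a b : g.Site, 0 ≤ g.dist a b) (hrow : RowSum g σ cr) (hσ : 0 ≤ σ) {ρ₁ ρ₂ δ δV β β₂ R : ℝ} (hβ : 0 ≤ β)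
    (hβ₂ : 0 ≤ β₂) (hR : 0 ≤ R) (hcr : 0 ≤ cr) (hσρ : σ ≤ ρ₁) (hρ₁V : ρ₁ ≤ δV) (hρ₁G : ρ₁ + σ ≤ δ) (hρ₂ : 0 ≤ ρ₂) (hρ₂₁ : ρ₂ + σ ≤ ρ₁) (hDq : ∀ j, D j = Dq j ∘ₗ G₀) (μ : J)
    {S : Set g.Site} {χX ψX ψ₂X : X → ℝ} (hSχ : ∀ x, χX x ≠ 0 → blk x ∈ S) (hSψ₂ : ∀ x, ψ₂X x ≠ 0 → blk x ∈ S) (hm : ∀ x, ψX x ≠ 0 → ψ₂X x = 1 ∧ ψ₂X (τ μ x) = 1)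
    (hGχ : mulOp (fun p : X × ι => χX p.1) ∘ₗ G₀ = G₀) (hGψ : G₀ ∘ₗ mulOp (fun p : X × ι => ψX p.1) = G₀)
    (hG : HasMaj (BlockNorm.ofBlocks g (liftBlk blk ι)) (BlockNorm.ofBlocks g (liftBlk blk ι)) G₀ (fun y y' => β * Real.exp (-(δ * g.dist y y'))))
    (hD : ∀ j, HasMaj (BlockNorm.ofBlocks g (liftBlk blk ι)) (BlockNorm.ofBlocks g (liftBlk blk ι)) (D j) (fun y y' => β * Real.exp (-(δ * g.dist y y'))))
    (hGQ : HasMaj (BlockNorm.ofBlocks g (liftBlk blk ι)) (BlockNorm.ofBlocks g (liftBlk blk ι)) (G₀ ∘ₗ fgrad n (liftEquiv (τ μ) ι)) (fun y y' => β₂ * Real.exp (-(δ * g.dist y y'))))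
    (hDQ : ∀ j, HasMaj (BlockNorm.ofBlocks g (liftBlk blk ι)) (BlockNorm.ofBlocks g (liftBlk blk ι)) (D j ∘ₗ fgrad n (liftEquiv (τ μ) ι)) (fun y y' => β₂ * Real.exp (-(δ * g.dist y y'))))
    (hV : HasMaj (BlockNorm.ofBlocks g (blkPair (liftBlk blk ι))) (BlockNorm.ofBlocks g (liftBlk blk ι)) V (fun y y' => R * Real.exp (-(δV * g.dist y y'))))
    (hq : β * (R * cr) * cr < 1) :
    HasMaj (BlockNorm.ofBlocks g (liftBlk blk ι)) (BlockNorm.ofBlocks g (liftBlk blk ι)) ((projO none ∘ₗ bgPropV (stack G₀ D) V) ∘ₗ fgrad n (liftEquiv (τ μ) ι))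
      (fun y y' => ind S y * ind S y' * (β₂ * (1 - β * (R * cr) * cr)⁻¹ * Real.exp (-(ρ₂ * g.dist y y')))) := by
  have hχ : mulOp (fun p : X × ι => χX p.1) ∘ₗ (projO none ∘ₗ stack G₀ D) = projO none ∘ₗ stack G₀ D := by rw [projO_none_comp_stack]; exact hGχ
  exact hasMaj_projO_dressedV_comp_loc₂ blk htri hd hrow hσ hβ hβ₂ hR hcr hσρ hρ₁V hρ₁G hρ₂ hρ₂₁ hDq none (fgrad n (liftEquiv (τ μ) ι)) hSχ hSψ₂ hχ hGψ
    (mulOp_comp_fgrad_comp_mulOp_of_margin n (τ μ) hm) hG hD hGQ hDQ hV hq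

/-- ★★ **`X∘∇⁻_μ`, TWO-SIDED** — FILE 49 ∕ file 14's `hDb` at `G := pr₀X̂`, margin `ψ₂ = 1` on `supp ψ ∪ τ_μ⁻¹(supp ψ)`. [cite: Balaban1984PropagatorsII, (2.133)–(2.134) p.247 (shapes); Balaban1985BackgroundPropagators, (3.42) p.397, (3.65) p.403] -/
theorem hasMaj_dressedV_comp_bgrad_loc₂ (htri : Triangle254 g) (hd : ∀ a b : g.Site, 0 ≤ g.dist a b) (hrow : RowSum g σ cr) (hσ : 0 ≤ σ) {ρ₁ ρ₂ δ δV β β₂ R : ℝ} (hβ : 0 ≤ β)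
    (hβ₂ : 0 ≤ β₂) (hR : 0 ≤ R) (hcr : 0 ≤ cr) (hσρ : σ ≤ ρ₁) (hρ₁V : ρ₁ ≤ δV) (hρ₁G : ρ₁ + σ ≤ δ) (hρ₂ : 0 ≤ ρ₂) (hρ₂₁ : ρ₂ + σ ≤ ρ₁) (hDq : ∀ j, D j = Dq j ∘ₗ G₀) (μ : J)
    {S : Set g.Site} {χX ψX ψ₂X : X → ℝ} (hSχ : ∀ x, χX x ≠ 0 → blk x ∈ S) (hSψ₂ : ∀ x, ψ₂X x ≠ 0 → blk x ∈ S) (hm : ∀ x, ψX x ≠ 0 → ψ₂X x = 1 ∧ ψ₂X ((τ μ).symm x) = 1)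
    (hGχ : mulOp (fun p : X × ι => χX p.1) ∘ₗ G₀ = G₀) (hGψ : G₀ ∘ₗ mulOp (fun p : X × ι => ψX p.1) = G₀)
    (hG : HasMaj (BlockNorm.ofBlocks g (liftBlk blk ι)) (BlockNorm.ofBlocks g (liftBlk blk ι)) G₀ (fun y y' => β * Real.exp (-(δ * g.dist y y'))))
    (hD : ∀ j, HasMaj (BlockNorm.ofBlocks g (liftBlk blk ι)) (BlockNorm.ofBlocks g (liftBlk blk ι)) (D j) (fun y y' => β * Real.exp (-(δ * g.dist y y'))))
    (hGQ : HasMaj (BlockNorm.ofBlocks g (liftBlk blk ι)) (BlockNorm.ofBlocks g (liftBlk blk ι)) (G₀ ∘ₗ bgrad n (liftEquiv (τ μ) ι)) (fun y y' => β₂ * Real.exp (-(δ * g.dist y y'))))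
    (hDQ : ∀ j, HasMaj (BlockNorm.ofBlocks g (liftBlk blk ι)) (BlockNorm.ofBlocks g (liftBlk blk ι)) (D j ∘ₗ bgrad n (liftEquiv (τ μ) ι)) (fun y y' => β₂ * Real.exp (-(δ * g.dist y y'))))
    (hV : HasMaj (BlockNorm.ofBlocks g (blkPair (liftBlk blk ι))) (BlockNorm.ofBlocks g (liftBlk blk ι)) V (fun y y' => R * Real.exp (-(δV * g.dist y y'))))
    (hq : β * (R * cr) * cr < 1) :
    HasMaj (BlockNorm.ofBlocks g (liftBlk blk ι)) (BlockNorm.ofBlocks g (liftBlk blk ι)) ((projO none ∘ₗ bgPropV (stack G₀ D) V) ∘ₗ bgrad n (liftEquiv (τ μ) ι))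
      (fun y y' => ind S y * ind S y' * (β₂ * (1 - β * (R * cr) * cr)⁻¹ * Real.exp (-(ρ₂ * g.dist y y')))) := by
  have hχ : mulOp (fun p : X × ι => χX p.1) ∘ₗ (projO none ∘ₗ stack G₀ D) = projO none ∘ₗ stack G₀ D := by rw [projO_none_comp_stack]; exact hGχ
  exact hasMaj_projO_dressedV_comp_loc₂ blk htri hd hrow hσ hβ hβ₂ hR hcr hσρ hρ₁V hρ₁G hρ₂ hρ₂₁ hDq none (bgrad n (liftEquiv (τ μ) ι)) hSχ hSψ₂ hχ hGψ
    (mulOp_comp_bgrad_comp_mulOp_of_margin n (τ μ) hm) hG hD hGQ hDQ hV hq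

end Rows

/-! ## §3 The η-defects of the right entries, two-sided localized -/

section Defects

variable {X X' ι J : Type} [Fintype X] [Fintype X'] [DecidableEq X] [DecidableEq X'] [Fintype ι] [DecidableEq ι] [Fintype J] [DecidableEq J] {g : B6.Geometry}
  (blk : X → g.Site) (π : X' → X) {σ cr : ℝ} {G₀ : (X × ι → ℝ) →ₗ[ℝ] (X × ι → ℝ)} {D Dq : J ⊕ J → (X × ι → ℝ) →ₗ[ℝ] (X × ι → ℝ)}
  {V : ((X × ι) × Option (J ⊕ J) → ℝ) →ₗ[ℝ] (X × ι → ℝ)} {G₀' : (X' × ι → ℝ) →ₗ[ℝ] (X' × ι → ℝ)} {D' Dq' : J ⊕ J → (X' × ι → ℝ) →ₗ[ℝ] (X' × ι → ℝ)}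
  {V' : ((X' × ι) × Option (J ⊕ J) → ℝ) →ₗ[ℝ] (X' × ι → ℝ)}

/-- ★★ **TWO-SIDED LOCALIZATION OF ANY DEFECT LETTER OF A RIGHT ENTRY**: the units at both grids, the cut-offs `χ, ψ ⊂ ψ₂` at both grids (coarse over `S` through `blk`, fine through `blk∘π`) and an
unlocalized letter `𝔇((pr_jX̂′)∘Q′, (pr_jX̂)∘Q) ≤ K` (`K ≥ 0`) ⟹ `≤ 1_S(y)1_S(y′)·K` (file 24 `idef_out_in` + FILE 47 `hasMaj_localize`). [cite: Balaban1984PropagatorsII, (2.133) p.247 (shape); Balaban1985BackgroundPropagators, Thm 3.14 pp.426–427 (template)] -/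
theorem hasMaj_idef_projO_dressedV_comp_loc₂_of (hDq : ∀ j, D j = Dq j ∘ₗ G₀) (hDq' : ∀ j, D' j = Dq' j ∘ₗ G₀') (hunit : IsUnit (1 - LinearMap.toMatrix' (stack G₀ D ∘ₗ V)))
    (hunit' : IsUnit (1 - LinearMap.toMatrix' (stack G₀' D' ∘ₗ V'))) (j : Option (J ⊕ J)) {Q : (X × ι → ℝ) →ₗ[ℝ] (X × ι → ℝ)} {Q' : (X' × ι → ℝ) →ₗ[ℝ] (X' × ι → ℝ)}
    {S : Set g.Site} {χX ψX ψ₂X : X → ℝ} {χX' ψX' ψ₂X' : X' → ℝ} (hSχ : ∀ x, χX x ≠ 0 → blk x ∈ S) (hSψ₂ : ∀ x, ψ₂X x ≠ 0 → blk x ∈ S)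
    (hSχ' : ∀ x', χX' x' ≠ 0 → blk (π x') ∈ S) (hSψ₂' : ∀ x', ψ₂X' x' ≠ 0 → blk (π x') ∈ S)
    (hχ : mulOp (fun p : X × ι => χX p.1) ∘ₗ (projO j ∘ₗ stack G₀ D) = projO j ∘ₗ stack G₀ D) (hGψ : G₀ ∘ₗ mulOp (fun p : X × ι => ψX p.1) = G₀)
    (hQ : mulOp (fun p : X × ι => ψX p.1) ∘ₗ Q ∘ₗ mulOp (fun p : X × ι => ψ₂X p.1) = mulOp (fun p : X × ι => ψX p.1) ∘ₗ Q)
    (hχ' : mulOp (fun p : X' × ι => χX' p.1) ∘ₗ (projO j ∘ₗ stack G₀' D') = projO j ∘ₗ stack G₀' D') (hGψ' : G₀' ∘ₗ mulOp (fun p : X' × ι => ψX' p.1) = G₀')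
    (hQ' : mulOp (fun p : X' × ι => ψX' p.1) ∘ₗ Q' ∘ₗ mulOp (fun p : X' × ι => ψ₂X' p.1) = mulOp (fun p : X' × ι => ψX' p.1) ∘ₗ Q') {K : g.Site → g.Site → ℝ}
    (hK : ∀ a b, 0 ≤ K a b)
    (hDXQ : HasMaj (BlockNorm.ofBlocks g (liftBlk blk ι)) (BlockNorm.ofBlocks g (liftBlk (blk ∘ π) ι))
      (idef (pull (liftMap π ι)) (pull (liftMap π ι)) ((projO j ∘ₗ bgPropV (stack G₀' D') V') ∘ₗ Q') ((projO j ∘ₗ bgPropV (stack G₀ D) V) ∘ₗ Q)) K) :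
    HasMaj (BlockNorm.ofBlocks g (liftBlk blk ι)) (BlockNorm.ofBlocks g (liftBlk (blk ∘ π) ι))
      (idef (pull (liftMap π ι)) (pull (liftMap π ι)) ((projO j ∘ₗ bgPropV (stack G₀' D') V') ∘ₗ Q') ((projO j ∘ₗ bgPropV (stack G₀ D) V) ∘ₗ Q)) (fun y y' => ind S y * ind S y' * K y y') := by
  obtain ⟨houtc, hinc⟩ := projO_dressedV_comp_cutoffs (V := V) hDq hunit j hχ hGψ hQ
  obtain ⟨houtf, hinf⟩ := projO_dressedV_comp_cutoffs (V := V') hDq' hunit' j hχ' hGψ' hQ'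
  obtain ⟨hout, hin⟩ := idef_out_in blk π hSχ hSψ₂ hSχ' hSψ₂' houtc hinc houtf hinf
  exact hasMaj_localize (liftBlk blk ι) (liftBlk (blk ∘ π) ι) hK hout hin hDXQ

omit [Fintype X] [Fintype X'] [DecidableEq X] [DecidableEq X'] [Fintype ι] [DecidableEq ι] [Fintype J] [DecidableEq J] in
/-- `pr_j` commutes with the defect against the right factor: `𝔇((pr_jX̂′)∘Q′, (pr_jX̂)∘Q) = pr_j∘𝔇(X̂′∘Q′, X̂∘Q)`. [folklore] -/
theorem idef_projO_comp_comp (j : Option (J ⊕ J)) (A : (X × ι → ℝ) →ₗ[ℝ] ((X × ι) × Option (J ⊕ J) → ℝ)) (A' : (X' × ι → ℝ) →ₗ[ℝ] ((X' × ι) × Option (J ⊕ J) → ℝ))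
    (Q : (X × ι → ℝ) →ₗ[ℝ] (X × ι → ℝ)) (Q' : (X' × ι → ℝ) →ₗ[ℝ] (X' × ι → ℝ)) :
    idef (pull (liftMap π ι)) (pull (liftMap π ι)) ((projO j ∘ₗ A') ∘ₗ Q') ((projO j ∘ₗ A) ∘ₗ Q) =
      projO j ∘ₗ idef (pull (liftMap π ι)) (pull (liftPair (liftMap π ι))) (A' ∘ₗ Q') (A ∘ₗ Q) :=
  LinearMap.ext fun _ => funext fun _ => rfl

/-- ★★ **THE η-DEFECT OF A RIGHT ENTRY, EVERY COMPONENT, TWO-SIDED LOCALIZED — FILE 55's `hIGE` PROPER**: file 25 `hasMaj_idef_dressedV_comp`'s letter (flat right entries `G₀Q, D_jQ ≤ β₂e^{−δd}` and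
their defects `≤ m_Qe^{−δd}`, the flat pieces' defects `≤ m_Ge^{−δd}`, the perturbation's letter `R` and fit `o`) read on component `j` and localized on both sides by the cut-offs at both grids:
`𝔇((pr_jX̂′)∘Q′, (pr_jX̂)∘Q) ≤ 1_S(y)1_S(y′)·(m_Qc_r + m_Gc_r·Rβ₂(1 − q)⁻¹c_r + βoc_r·β₂(1 − q)⁻¹c_r)(1 − q)⁻¹e^{−ρ₂d}`, `q = βRc_r²`.
[cite: Balaban1984PropagatorsII, (2.133) p.247 (shape); Balaban1985BackgroundPropagators, (3.42) p.397 (entry 2), Thm 3.14 pp.426–427 (template)] -/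
theorem hasMaj_idef_projO_dressedV_comp_loc₂ (htri : Triangle254 g) (hd : ∀ a b : g.Site, 0 ≤ g.dist a b) (hrow : RowSum g σ cr) (hσ : 0 ≤ σ) (hcr : 0 ≤ cr)
    {ρ₁ ρ₂ δ δV β β₂ R o mG mQ : ℝ} (hβ : 0 ≤ β) (hβ₂ : 0 ≤ β₂) (hR : 0 ≤ R) (ho : 0 ≤ o) (hmG : 0 ≤ mG) (hmQ : 0 ≤ mQ) (hσρ : σ ≤ ρ₁) (hρ₁V : ρ₁ ≤ δV)
    (hρ₁G : ρ₁ + σ ≤ δ) (hρ₂ : 0 ≤ ρ₂) (hρ₂₁ : ρ₂ + σ ≤ ρ₁) (hDq : ∀ j, D j = Dq j ∘ₗ G₀) (hDq' : ∀ j, D' j = Dq' j ∘ₗ G₀') (j : Option (J ⊕ J))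
    (Q : (X × ι → ℝ) →ₗ[ℝ] (X × ι → ℝ)) (Q' : (X' × ι → ℝ) →ₗ[ℝ] (X' × ι → ℝ)) {S : Set g.Site} {χX ψX ψ₂X : X → ℝ} {χX' ψX' ψ₂X' : X' → ℝ}
    (hSχ : ∀ x, χX x ≠ 0 → blk x ∈ S) (hSψ₂ : ∀ x, ψ₂X x ≠ 0 → blk x ∈ S) (hSχ' : ∀ x', χX' x' ≠ 0 → blk (π x') ∈ S) (hSψ₂' : ∀ x', ψ₂X' x' ≠ 0 → blk (π x') ∈ S)
    (hχ : mulOp (fun p : X × ι => χX p.1) ∘ₗ (projO j ∘ₗ stack G₀ D) = projO j ∘ₗ stack G₀ D) (hGψ : G₀ ∘ₗ mulOp (fun p : X × ι => ψX p.1) = G₀)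
    (hQ : mulOp (fun p : X × ι => ψX p.1) ∘ₗ Q ∘ₗ mulOp (fun p : X × ι => ψ₂X p.1) = mulOp (fun p : X × ι => ψX p.1) ∘ₗ Q)
    (hχ' : mulOp (fun p : X' × ι => χX' p.1) ∘ₗ (projO j ∘ₗ stack G₀' D') = projO j ∘ₗ stack G₀' D') (hGψ' : G₀' ∘ₗ mulOp (fun p : X' × ι => ψX' p.1) = G₀')
    (hQ' : mulOp (fun p : X' × ι => ψX' p.1) ∘ₗ Q' ∘ₗ mulOp (fun p : X' × ι => ψ₂X' p.1) = mulOp (fun p : X' × ι => ψX' p.1) ∘ₗ Q')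
    (hG : HasMaj (BlockNorm.ofBlocks g (liftBlk blk ι)) (BlockNorm.ofBlocks g (liftBlk blk ι)) G₀ (fun y y' => β * Real.exp (-(δ * g.dist y y'))))
    (hD : ∀ j, HasMaj (BlockNorm.ofBlocks g (liftBlk blk ι)) (BlockNorm.ofBlocks g (liftBlk blk ι)) (D j) (fun y y' => β * Real.exp (-(δ * g.dist y y'))))
    (hG' : HasMaj (BlockNorm.ofBlocks g (liftBlk (blk ∘ π) ι)) (BlockNorm.ofBlocks g (liftBlk (blk ∘ π) ι)) G₀' (fun y y' => β * Real.exp (-(δ * g.dist y y'))))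
    (hD' : ∀ j, HasMaj (BlockNorm.ofBlocks g (liftBlk (blk ∘ π) ι)) (BlockNorm.ofBlocks g (liftBlk (blk ∘ π) ι)) (D' j) (fun y y' => β * Real.exp (-(δ * g.dist y y'))))
    (hDG : HasMaj (BlockNorm.ofBlocks g (liftBlk blk ι)) (BlockNorm.ofBlocks g (liftBlk (blk ∘ π) ι)) (idef (pull (liftMap π ι)) (pull (liftMap π ι)) G₀' G₀)
      (fun y y' => mG * Real.exp (-(δ * g.dist y y'))))
    (hDD : ∀ j, HasMaj (BlockNorm.ofBlocks g (liftBlk blk ι)) (BlockNorm.ofBlocks g (liftBlk (blk ∘ π) ι)) (idef (pull (liftMap π ι)) (pull (liftMap π ι)) (D' j) (D j))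
      (fun y y' => mG * Real.exp (-(δ * g.dist y y'))))
    (hGQ : HasMaj (BlockNorm.ofBlocks g (liftBlk blk ι)) (BlockNorm.ofBlocks g (liftBlk blk ι)) (G₀ ∘ₗ Q) (fun y y' => β₂ * Real.exp (-(δ * g.dist y y'))))
    (hDQ : ∀ j, HasMaj (BlockNorm.ofBlocks g (liftBlk blk ι)) (BlockNorm.ofBlocks g (liftBlk blk ι)) (D j ∘ₗ Q) (fun y y' => β₂ * Real.exp (-(δ * g.dist y y'))))
    (hDGQ : HasMaj (BlockNorm.ofBlocks g (liftBlk blk ι)) (BlockNorm.ofBlocks g (liftBlk (blk ∘ π) ι))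
      (idef (pull (liftMap π ι)) (pull (liftMap π ι)) (G₀' ∘ₗ Q') (G₀ ∘ₗ Q)) (fun y y' => mQ * Real.exp (-(δ * g.dist y y'))))
    (hDDQ : ∀ j, HasMaj (BlockNorm.ofBlocks g (liftBlk blk ι)) (BlockNorm.ofBlocks g (liftBlk (blk ∘ π) ι))
      (idef (pull (liftMap π ι)) (pull (liftMap π ι)) (D' j ∘ₗ Q') (D j ∘ₗ Q)) (fun y y' => mQ * Real.exp (-(δ * g.dist y y'))))
    (hV : HasMaj (BlockNorm.ofBlocks g (blkPair (liftBlk blk ι))) (BlockNorm.ofBlocks g (liftBlk blk ι)) V (fun y y' => R * Real.exp (-(δV * g.dist y y'))))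
    (hV' : HasMaj (BlockNorm.ofBlocks g (blkPair (liftBlk (blk ∘ π) ι))) (BlockNorm.ofBlocks g (liftBlk (blk ∘ π) ι)) V' (fun y y' => R * Real.exp (-(δV * g.dist y y'))))
    (hDV : HasMaj (BlockNorm.ofBlocks g (blkPair (liftBlk blk ι))) (BlockNorm.ofBlocks g (liftBlk (blk ∘ π) ι))
      (idef (pull (liftPair (liftMap π ι))) (pull (liftMap π ι)) V' V) (fun y y' => o * Real.exp (-(δV * g.dist y y'))))
    (hq : β * (R * cr) * cr < 1) :
    HasMaj (BlockNorm.ofBlocks g (liftBlk blk ι)) (BlockNorm.ofBlocks g (liftBlk (blk ∘ π) ι))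
      (idef (pull (liftMap π ι)) (pull (liftMap π ι)) ((projO j ∘ₗ bgPropV (stack G₀' D') V') ∘ₗ Q') ((projO j ∘ₗ bgPropV (stack G₀ D) V) ∘ₗ Q))
      (fun y y' => ind S y * ind S y' *
        ((mQ * cr + mG * cr * (R * (β₂ * (1 - β * (R * cr) * cr)⁻¹) * cr) + β * o * cr * (β₂ * (1 - β * (R * cr) * cr)⁻¹) * cr) * (1 - β * (R * cr) * cr)⁻¹ *
          Real.exp (-(ρ₂ * g.dist y y')))) := by
  have key0 := hasMaj_idef_dressedV_comp blk π htri hd hrow hσ hcr hβ hβ₂ hR ho hmG hmQ hσρ hρ₁V hρ₁G hρ₂ hρ₂₁ Q Q' hG hD hG' hD' hDG hDD hGQ hDQ hDGQ hDDQ hV hV' hDV hq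
  have hq' : 0 < 1 - β * (R * cr) * cr := by linarith
  have hi : 0 ≤ (1 - β * (R * cr) * cr)⁻¹ := inv_nonneg.2 hq'.le
  have key : HasMaj (BlockNorm.ofBlocks g (liftBlk blk ι)) (BlockNorm.ofBlocks g (liftBlk (blk ∘ π) ι))
      (idef (pull (liftMap π ι)) (pull (liftMap π ι)) ((projO j ∘ₗ bgPropV (stack G₀' D') V') ∘ₗ Q') ((projO j ∘ₗ bgPropV (stack G₀ D) V) ∘ₗ Q))
      (fun y y' => (mQ * cr + mG * cr * (R * (β₂ * (1 - β * (R * cr) * cr)⁻¹) * cr) + β * o * cr * (β₂ * (1 - β * (R * cr) * cr)⁻¹) * cr) * (1 - β * (R * cr) * cr)⁻¹ *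
        Real.exp (-(ρ₂ * g.dist y y'))) := by
    rw [idef_projO_comp_comp]
    refine (hasMaj_projO_comp (liftBlk (blk ∘ π) ι) key0 j).mono fun y y' => le_of_eq ?_
    simp only [one_mul, mul_one]
  have hK0 : ∀ a b : g.Site, 0 ≤ (mQ * cr + mG * cr * (R * (β₂ * (1 - β * (R * cr) * cr)⁻¹) * cr) + β * o * cr * (β₂ * (1 - β * (R * cr) * cr)⁻¹) * cr) * (1 - β * (R * cr) * cr)⁻¹ *
      Real.exp (-(ρ₂ * g.dist a b)) := fun a b => by positivity
  obtain ⟨hunit, -⟩ := hasMaj_dressedV_pair blk htri hd hrow hσ hβ hR hcr hσρ hρ₁V hρ₁G hρ₂ hρ₂₁ hG hD hV hq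
  obtain ⟨hunit', -⟩ := hasMaj_dressedV_pair (blk ∘ π) htri hd hrow hσ hβ hR hcr hσρ hρ₁V hρ₁G hρ₂ hρ₂₁ hG' hD' hV' hq
  exact hasMaj_idef_projO_dressedV_comp_loc₂_of blk π hDq hDq' hunit hunit' j hSχ hSψ₂ hSχ' hSψ₂' hχ hGψ hQ hχ' hGψ' hQ' hK0 key

variable (τ : J → X ≃ X) (τ' : J → X' ≃ X') (n n' : ℝ)

/-- ★★ **THE η-DEFECT OF `X∘∇⁺_μ`, TWO-SIDED** (file 15 ∕ FILE 53-type `hDD` input at `G := pr₀X̂`): the two grids' flat right entries `G₀∘∇⁺_μ, D_j∘∇⁺_μ` (fine: `η′`-quotients `∇′⁺_μ`), their letters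
`β₂` and defects `m_Q`, the flat pieces' defects `m_G`, the cut-offs `χ, ψ` with one-step margins `ψ₂` at both grids ⟹ `𝔇(X′∘∇′⁺_μ, X∘∇⁺_μ) ≤ 1_S(y)1_S(y′)·(…)(1 − q)⁻¹e^{−ρ₂d}`.
[cite: Balaban1984PropagatorsII, (2.133)–(2.134) p.247 (shapes); Balaban1985BackgroundPropagators, Thm 3.14 pp.426–427 (template)] -/
theorem hasMaj_idef_dressedV_comp_fgrad_loc₂ (htri : Triangle254 g) (hd : ∀ a b : g.Site, 0 ≤ g.dist a b) (hrow : RowSum g σ cr) (hσ : 0 ≤ σ) (hcr : 0 ≤ cr)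
    {ρ₁ ρ₂ δ δV β β₂ R o mG mQ : ℝ} (hβ : 0 ≤ β) (hβ₂ : 0 ≤ β₂) (hR : 0 ≤ R) (ho : 0 ≤ o) (hmG : 0 ≤ mG) (hmQ : 0 ≤ mQ) (hσρ : σ ≤ ρ₁) (hρ₁V : ρ₁ ≤ δV)
    (hρ₁G : ρ₁ + σ ≤ δ) (hρ₂ : 0 ≤ ρ₂) (hρ₂₁ : ρ₂ + σ ≤ ρ₁) (hDq : ∀ j, D j = Dq j ∘ₗ G₀) (hDq' : ∀ j, D' j = Dq' j ∘ₗ G₀') (μ : J)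
    {S : Set g.Site} {χX ψX ψ₂X : X → ℝ} {χX' ψX' ψ₂X' : X' → ℝ}
    (hSχ : ∀ x, χX x ≠ 0 → blk x ∈ S) (hSψ₂ : ∀ x, ψ₂X x ≠ 0 → blk x ∈ S) (hSχ' : ∀ x', χX' x' ≠ 0 → blk (π x') ∈ S) (hSψ₂' : ∀ x', ψ₂X' x' ≠ 0 → blk (π x') ∈ S)
    (hm : ∀ x, ψX x ≠ 0 → ψ₂X x = 1 ∧ ψ₂X (τ μ x) = 1) (hm' : ∀ x', ψX' x' ≠ 0 → ψ₂X' x' = 1 ∧ ψ₂X' (τ' μ x') = 1)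
    (hGχ : mulOp (fun p : X × ι => χX p.1) ∘ₗ G₀ = G₀) (hGψ : G₀ ∘ₗ mulOp (fun p : X × ι => ψX p.1) = G₀)
    (hGχ' : mulOp (fun p : X' × ι => χX' p.1) ∘ₗ G₀' = G₀') (hGψ' : G₀' ∘ₗ mulOp (fun p : X' × ι => ψX' p.1) = G₀')
    (hG : HasMaj (BlockNorm.ofBlocks g (liftBlk blk ι)) (BlockNorm.ofBlocks g (liftBlk blk ι)) G₀ (fun y y' => β * Real.exp (-(δ * g.dist y y'))))
    (hD : ∀ j, HasMaj (BlockNorm.ofBlocks g (liftBlk blk ι)) (BlockNorm.ofBlocks g (liftBlk blk ι)) (D j) (fun y y' => β * Real.exp (-(δ * g.dist y y'))))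
    (hG' : HasMaj (BlockNorm.ofBlocks g (liftBlk (blk ∘ π) ι)) (BlockNorm.ofBlocks g (liftBlk (blk ∘ π) ι)) G₀' (fun y y' => β * Real.exp (-(δ * g.dist y y'))))
    (hD' : ∀ j, HasMaj (BlockNorm.ofBlocks g (liftBlk (blk ∘ π) ι)) (BlockNorm.ofBlocks g (liftBlk (blk ∘ π) ι)) (D' j) (fun y y' => β * Real.exp (-(δ * g.dist y y'))))
    (hDG : HasMaj (BlockNorm.ofBlocks g (liftBlk blk ι)) (BlockNorm.ofBlocks g (liftBlk (blk ∘ π) ι)) (idef (pull (liftMap π ι)) (pull (liftMap π ι)) G₀' G₀)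
      (fun y y' => mG * Real.exp (-(δ * g.dist y y'))))
    (hDD : ∀ j, HasMaj (BlockNorm.ofBlocks g (liftBlk blk ι)) (BlockNorm.ofBlocks g (liftBlk (blk ∘ π) ι)) (idef (pull (liftMap π ι)) (pull (liftMap π ι)) (D' j) (D j))
      (fun y y' => mG * Real.exp (-(δ * g.dist y y'))))
    (hGQ : HasMaj (BlockNorm.ofBlocks g (liftBlk blk ι)) (BlockNorm.ofBlocks g (liftBlk blk ι)) (G₀ ∘ₗ fgrad n (liftEquiv (τ μ) ι)) (fun y y' => β₂ * Real.exp (-(δ * g.dist y y'))))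
    (hDQ : ∀ j, HasMaj (BlockNorm.ofBlocks g (liftBlk blk ι)) (BlockNorm.ofBlocks g (liftBlk blk ι)) (D j ∘ₗ fgrad n (liftEquiv (τ μ) ι)) (fun y y' => β₂ * Real.exp (-(δ * g.dist y y'))))
    (hDGQ : HasMaj (BlockNorm.ofBlocks g (liftBlk blk ι)) (BlockNorm.ofBlocks g (liftBlk (blk ∘ π) ι))
      (idef (pull (liftMap π ι)) (pull (liftMap π ι)) (G₀' ∘ₗ fgrad n' (liftEquiv (τ' μ) ι)) (G₀ ∘ₗ fgrad n (liftEquiv (τ μ) ι))) (fun y y' => mQ * Real.exp (-(δ * g.dist y y'))))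
    (hDDQ : ∀ j, HasMaj (BlockNorm.ofBlocks g (liftBlk blk ι)) (BlockNorm.ofBlocks g (liftBlk (blk ∘ π) ι))
      (idef (pull (liftMap π ι)) (pull (liftMap π ι)) (D' j ∘ₗ fgrad n' (liftEquiv (τ' μ) ι)) (D j ∘ₗ fgrad n (liftEquiv (τ μ) ι))) (fun y y' => mQ * Real.exp (-(δ * g.dist y y'))))
    (hV : HasMaj (BlockNorm.ofBlocks g (blkPair (liftBlk blk ι))) (BlockNorm.ofBlocks g (liftBlk blk ι)) V (fun y y' => R * Real.exp (-(δV * g.dist y y'))))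
    (hV' : HasMaj (BlockNorm.ofBlocks g (blkPair (liftBlk (blk ∘ π) ι))) (BlockNorm.ofBlocks g (liftBlk (blk ∘ π) ι)) V' (fun y y' => R * Real.exp (-(δV * g.dist y y'))))
    (hDV : HasMaj (BlockNorm.ofBlocks g (blkPair (liftBlk blk ι))) (BlockNorm.ofBlocks g (liftBlk (blk ∘ π) ι))
      (idef (pull (liftPair (liftMap π ι))) (pull (liftMap π ι)) V' V) (fun y y' => o * Real.exp (-(δV * g.dist y y'))))
    (hq : β * (R * cr) * cr < 1) :
    HasMaj (BlockNorm.ofBlocks g (liftBlk blk ι)) (BlockNorm.ofBlocks g (liftBlk (blk ∘ π) ι))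
      (idef (pull (liftMap π ι)) (pull (liftMap π ι)) ((projO none ∘ₗ bgPropV (stack G₀' D') V') ∘ₗ fgrad n' (liftEquiv (τ' μ) ι))
        ((projO none ∘ₗ bgPropV (stack G₀ D) V) ∘ₗ fgrad n (liftEquiv (τ μ) ι)))
      (fun y y' => ind S y * ind S y' *
        ((mQ * cr + mG * cr * (R * (β₂ * (1 - β * (R * cr) * cr)⁻¹) * cr) + β * o * cr * (β₂ * (1 - β * (R * cr) * cr)⁻¹) * cr) * (1 - β * (R * cr) * cr)⁻¹ *
          Real.exp (-(ρ₂ * g.dist y y')))) := by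
  have hχ : mulOp (fun p : X × ι => χX p.1) ∘ₗ (projO none ∘ₗ stack G₀ D) = projO none ∘ₗ stack G₀ D := by rw [projO_none_comp_stack]; exact hGχ
  have hχ' : mulOp (fun p : X' × ι => χX' p.1) ∘ₗ (projO none ∘ₗ stack G₀' D') = projO none ∘ₗ stack G₀' D' := by rw [projO_none_comp_stack]; exact hGχ'
  exact hasMaj_idef_projO_dressedV_comp_loc₂ blk π htri hd hrow hσ hcr hβ hβ₂ hR ho hmG hmQ hσρ hρ₁V hρ₁G hρ₂ hρ₂₁ hDq hDq' none (fgrad n (liftEquiv (τ μ) ι))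
    (fgrad n' (liftEquiv (τ' μ) ι)) hSχ hSψ₂ hSχ' hSψ₂' hχ hGψ (mulOp_comp_fgrad_comp_mulOp_of_margin n (τ μ) hm) hχ' hGψ' (mulOp_comp_fgrad_comp_mulOp_of_margin n' (τ' μ) hm')
    hG hD hG' hD' hDG hDD hGQ hDQ hDGQ hDDQ hV hV' hDV hq

/-- ★★ **THE η-DEFECT OF `X∘∇⁻_μ`, TWO-SIDED** (the `hDDb` twin), margins `ψ₂ = 1` on `supp ψ ∪ τ_μ⁻¹(supp ψ)` at both grids. [cite: Balaban1984PropagatorsII, (2.133)–(2.134) p.247 (shapes); Balaban1985BackgroundPropagators, Thm 3.14 pp.426–427 (template)] -/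
theorem hasMaj_idef_dressedV_comp_bgrad_loc₂ (htri : Triangle254 g) (hd : ∀ a b : g.Site, 0 ≤ g.dist a b) (hrow : RowSum g σ cr) (hσ : 0 ≤ σ) (hcr : 0 ≤ cr)
    {ρ₁ ρ₂ δ δV β β₂ R o mG mQ : ℝ} (hβ : 0 ≤ β) (hβ₂ : 0 ≤ β₂) (hR : 0 ≤ R) (ho : 0 ≤ o) (hmG : 0 ≤ mG) (hmQ : 0 ≤ mQ) (hσρ : σ ≤ ρ₁) (hρ₁V : ρ₁ ≤ δV)
    (hρ₁G : ρ₁ + σ ≤ δ) (hρ₂ : 0 ≤ ρ₂) (hρ₂₁ : ρ₂ + σ ≤ ρ₁) (hDq : ∀ j, D j = Dq j ∘ₗ G₀) (hDq' : ∀ j, D' j = Dq' j ∘ₗ G₀') (μ : J)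
    {S : Set g.Site} {χX ψX ψ₂X : X → ℝ} {χX' ψX' ψ₂X' : X' → ℝ}
    (hSχ : ∀ x, χX x ≠ 0 → blk x ∈ S) (hSψ₂ : ∀ x, ψ₂X x ≠ 0 → blk x ∈ S) (hSχ' : ∀ x', χX' x' ≠ 0 → blk (π x') ∈ S) (hSψ₂' : ∀ x', ψ₂X' x' ≠ 0 → blk (π x') ∈ S)
    (hm : ∀ x, ψX x ≠ 0 → ψ₂X x = 1 ∧ ψ₂X ((τ μ).symm x) = 1) (hm' : ∀ x', ψX' x' ≠ 0 → ψ₂X' x' = 1 ∧ ψ₂X' ((τ' μ).symm x') = 1)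
    (hGχ : mulOp (fun p : X × ι => χX p.1) ∘ₗ G₀ = G₀) (hGψ : G₀ ∘ₗ mulOp (fun p : X × ι => ψX p.1) = G₀)
    (hGχ' : mulOp (fun p : X' × ι => χX' p.1) ∘ₗ G₀' = G₀') (hGψ' : G₀' ∘ₗ mulOp (fun p : X' × ι => ψX' p.1) = G₀')
    (hG : HasMaj (BlockNorm.ofBlocks g (liftBlk blk ι)) (BlockNorm.ofBlocks g (liftBlk blk ι)) G₀ (fun y y' => β * Real.exp (-(δ * g.dist y y'))))
    (hD : ∀ j, HasMaj (BlockNorm.ofBlocks g (liftBlk blk ι)) (BlockNorm.ofBlocks g (liftBlk blk ι)) (D j) (fun y y' => β * Real.exp (-(δ * g.dist y y'))))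
    (hG' : HasMaj (BlockNorm.ofBlocks g (liftBlk (blk ∘ π) ι)) (BlockNorm.ofBlocks g (liftBlk (blk ∘ π) ι)) G₀' (fun y y' => β * Real.exp (-(δ * g.dist y y'))))
    (hD' : ∀ j, HasMaj (BlockNorm.ofBlocks g (liftBlk (blk ∘ π) ι)) (BlockNorm.ofBlocks g (liftBlk (blk ∘ π) ι)) (D' j) (fun y y' => β * Real.exp (-(δ * g.dist y y'))))
    (hDG : HasMaj (BlockNorm.ofBlocks g (liftBlk blk ι)) (BlockNorm.ofBlocks g (liftBlk (blk ∘ π) ι)) (idef (pull (liftMap π ι)) (pull (liftMap π ι)) G₀' G₀)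
      (fun y y' => mG * Real.exp (-(δ * g.dist y y'))))
    (hDD : ∀ j, HasMaj (BlockNorm.ofBlocks g (liftBlk blk ι)) (BlockNorm.ofBlocks g (liftBlk (blk ∘ π) ι)) (idef (pull (liftMap π ι)) (pull (liftMap π ι)) (D' j) (D j))
      (fun y y' => mG * Real.exp (-(δ * g.dist y y'))))
    (hGQ : HasMaj (BlockNorm.ofBlocks g (liftBlk blk ι)) (BlockNorm.ofBlocks g (liftBlk blk ι)) (G₀ ∘ₗ bgrad n (liftEquiv (τ μ) ι)) (fun y y' => β₂ * Real.exp (-(δ * g.dist y y'))))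
    (hDQ : ∀ j, HasMaj (BlockNorm.ofBlocks g (liftBlk blk ι)) (BlockNorm.ofBlocks g (liftBlk blk ι)) (D j ∘ₗ bgrad n (liftEquiv (τ μ) ι)) (fun y y' => β₂ * Real.exp (-(δ * g.dist y y'))))
    (hDGQ : HasMaj (BlockNorm.ofBlocks g (liftBlk blk ι)) (BlockNorm.ofBlocks g (liftBlk (blk ∘ π) ι))
      (idef (pull (liftMap π ι)) (pull (liftMap π ι)) (G₀' ∘ₗ bgrad n' (liftEquiv (τ' μ) ι)) (G₀ ∘ₗ bgrad n (liftEquiv (τ μ) ι))) (fun y y' => mQ * Real.exp (-(δ * g.dist y y'))))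
    (hDDQ : ∀ j, HasMaj (BlockNorm.ofBlocks g (liftBlk blk ι)) (BlockNorm.ofBlocks g (liftBlk (blk ∘ π) ι))
      (idef (pull (liftMap π ι)) (pull (liftMap π ι)) (D' j ∘ₗ bgrad n' (liftEquiv (τ' μ) ι)) (D j ∘ₗ bgrad n (liftEquiv (τ μ) ι))) (fun y y' => mQ * Real.exp (-(δ * g.dist y y'))))
    (hV : HasMaj (BlockNorm.ofBlocks g (blkPair (liftBlk blk ι))) (BlockNorm.ofBlocks g (liftBlk blk ι)) V (fun y y' => R * Real.exp (-(δV * g.dist y y'))))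
    (hV' : HasMaj (BlockNorm.ofBlocks g (blkPair (liftBlk (blk ∘ π) ι))) (BlockNorm.ofBlocks g (liftBlk (blk ∘ π) ι)) V' (fun y y' => R * Real.exp (-(δV * g.dist y y'))))
    (hDV : HasMaj (BlockNorm.ofBlocks g (blkPair (liftBlk blk ι))) (BlockNorm.ofBlocks g (liftBlk (blk ∘ π) ι))
      (idef (pull (liftPair (liftMap π ι))) (pull (liftMap π ι)) V' V) (fun y y' => o * Real.exp (-(δV * g.dist y y'))))
    (hq : β * (R * cr) * cr < 1) :
    HasMaj (BlockNorm.ofBlocks g (liftBlk blk ι)) (BlockNorm.ofBlocks g (liftBlk (blk ∘ π) ι))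
      (idef (pull (liftMap π ι)) (pull (liftMap π ι)) ((projO none ∘ₗ bgPropV (stack G₀' D') V') ∘ₗ bgrad n' (liftEquiv (τ' μ) ι))
        ((projO none ∘ₗ bgPropV (stack G₀ D) V) ∘ₗ bgrad n (liftEquiv (τ μ) ι)))
      (fun y y' => ind S y * ind S y' *
        ((mQ * cr + mG * cr * (R * (β₂ * (1 - β * (R * cr) * cr)⁻¹) * cr) + β * o * cr * (β₂ * (1 - β * (R * cr) * cr)⁻¹) * cr) * (1 - β * (R * cr) * cr)⁻¹ *
          Real.exp (-(ρ₂ * g.dist y y')))) := by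
  have hχ : mulOp (fun p : X × ι => χX p.1) ∘ₗ (projO none ∘ₗ stack G₀ D) = projO none ∘ₗ stack G₀ D := by rw [projO_none_comp_stack]; exact hGχ
  have hχ' : mulOp (fun p : X' × ι => χX' p.1) ∘ₗ (projO none ∘ₗ stack G₀' D') = projO none ∘ₗ stack G₀' D' := by rw [projO_none_comp_stack]; exact hGχ'
  exact hasMaj_idef_projO_dressedV_comp_loc₂ blk π htri hd hrow hσ hcr hβ hβ₂ hR ho hmG hmQ hσρ hρ₁V hρ₁G hρ₂ hρ₂₁ hDq hDq' none (bgrad n (liftEquiv (τ μ) ι))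
    (bgrad n' (liftEquiv (τ' μ) ι)) hSχ hSψ₂ hSχ' hSψ₂' hχ hGψ (mulOp_comp_bgrad_comp_mulOp_of_margin n (τ μ) hm) hχ' hGψ' (mulOp_comp_bgrad_comp_mulOp_of_margin n' (τ' μ) hm')
    hG hD hG' hD' hDG hDD hGQ hDQ hDGQ hDDQ hV hV' hDV hq

end Defects

end Summit.QuantumFields.YangMills.BalabanUVNodes.N15.CurvedSpecies

end
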